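import Summits.BirchSwinnertonDyer.Rank1Residual.ManinAdditive.NeronOmegaThreeFrickeTraceHolds
import Summits.BirchSwinnertonDyer.Rank1Residual.ManinAdditive.NeronOmegaTwo
import Summits.BirchSwinnertonDyer.BirchSwinnertonDyer.Theorems.ManinLocalTwoThreeQuarterEighthTranslate
import HarnessLib

/-!
TYPER HEADER (bsd-f2-manin-ty g16, 2026-08-29; typer initiative after T-imc-30) — PROVED SUPPORT NODE, theorem-only file.
imc's support row **E-imc-163s `NeronOmegaTwo.TraceQuarterIdentityAtTwo`** (typed in `NeronOmegaTwo.lean`, p682526) is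
PROVED here: **`traceQuarterIdentityAtTwo_holds : TraceQuarterIdentityAtTwo`** — for `N = 4M`, `4 ∣ M` and
`y ∈ S₂(Γ₀(N))`, `ι(Tr^N_M y) = y + W t_{1/2} W y + W R₄ W y`.  It is the `p = 2` twin of
`NeronOmegaThreeFrickeTraceHolds.traceTranslateIdentityAtThree_holds` and is proved the same way:

* §1 the index-`4` coset decomposition `Γ₀(4M) · 1 · Γ₀(M) = ⊔_{j<4} Γ₀(4M)(1 0; Mj 1)` for `4 ∣ M`
  (`isDoubleCosetDecomp_gamma0_four_mul`; uniqueness of `j` because the lower-right entry of an element of `Γ₀(M)` is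
  prime to `4`, `existsUnique_fin_dvd_sub_mul_of_isCoprime`), hence the four-term coset sum
  `coe_adjDegeneracyMap0_one_four_mul_eq_sum` (tree: `adjDegeneracyMap0_one_eq_restrictLevel`, `coe_restrictLevel_eq_sum`);
* §2 pointwise `W t_{j/4} W = ∣(1 0; −Mj 1)` (`fricke_quarterTranslate_fricke_apply`, from p2's
  `cuspHeckeOperator_upperTranslate_two_apply` via `quarterTranslate_two_apply`) and `t_{1/2} = t_{2/4}` at `16 ∣ N`
  (`halfTranslate_two_eq_quarterTranslate_two`, `fricke_halfTranslate_fricke_apply`);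
* §3 assembly (`traceQuarterIdentity`): `ι ∘ Tr = Σ_{j<4} ∣(1 0; Mj 1)` (tree `coe_degeneracyMap0_one`), the slashes by
  `(1 0; Mj 1)` and `(1 0; (j−4)M 1)` agree on level `4M` (`slash_lowerUnipotent_eq_of_dvd_sub`), and
  `R₄ = t_{1/4} + t_{3/4}` (`ramanujanFour_eq_quarterTranslate_add`).
Routine (Diamond–Shurman §5.1 special case (3); Atkin–Lehner 1970 §4).  HONEST FRAMING: a bookkeeping identity; it does not
prove E-imc-162/163/164♭, nor C2, nor Manin's conjecture, nor BSD.
-/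

noncomputable section

open scoped MatrixGroups ModularForm
open CongruenceSubgroup UpperHalfPlane Matrix.SpecialLinearGroup
  Literature.NumberTheory.EllipticCurves.ModularForms
  Summit.BirchSwinnertonDyer.Rank1Residual.ManinAdditive
  Summit.BirchSwinnertonDyer.Rank1Residual.ManinAdditive.ConwayCut
  Summit.BirchSwinnertonDyer.Rank1Residual.ManinAdditive.NeronConway
  Summit.BirchSwinnertonDyer.Rank1Residual.ManinAdditive.NeronConwayTw
  Summit.BirchSwinnertonDyer.Rank1Residual.ManinAdditive.NeronOmegaThree
  Summit.BirchSwinnertonDyer.BirchSwinnertonDyer.Theorems.ManinLocalTwoThree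

namespace Summit.BirchSwinnertonDyer.Rank1Residual.ManinAdditive.NeronOmegaTwo

/-! ### §1 Coset representatives of `Γ₀(4M) \ Γ₀(M)` for `4 ∣ M` -/

/-- For `n` coprime to `d`, the congruence `c ≡ j d (mod n)` has exactly one solution `j mod n`. -/
theorem existsUnique_fin_dvd_sub_mul_of_isCoprime (n : ℕ) [NeZero n] (c d : ℤ) (hd : IsCoprime (n : ℤ) d) :
    ∃! j : Fin n, (n : ℤ) ∣ c - ((j : ℕ) : ℤ) * d := by
  have hu : IsUnit (d : ZMod n) := by
    obtain ⟨u, v, huv⟩ := hd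
    have := congrArg (Int.cast : ℤ → ZMod n) huv
    push_cast at this
    rw [ZMod.natCast_self, mul_zero, zero_add] at this
    exact IsUnit.of_mul_eq_one_right _ this
  obtain ⟨du, hdu⟩ := hu
  refine ⟨⟨((c : ZMod n) * (du⁻¹ : (ZMod n)ˣ)).val, ZMod.val_lt _⟩, ?_, ?_⟩
  · show (n : ℤ) ∣ c - (((((c : ZMod n) * (du⁻¹ : (ZMod n)ˣ)).val : ℕ) : ℤ)) * d
    rw [← ZMod.intCast_zmod_eq_zero_iff_dvd]
    push_cast
    rw [ZMod.natCast_zmod_val, ← hdu, mul_assoc, Units.inv_mul, mul_one, sub_self]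
  · rintro ⟨j, hj⟩ hdiv
    apply Fin.ext
    show j = _
    have h1 : ((j : ZMod n)) * d = c := by
      rw [← ZMod.intCast_zmod_eq_zero_iff_dvd] at hdiv
      push_cast at hdiv
      rw [sub_eq_zero] at hdiv
      exact hdiv.symm
    have h2 : (j : ZMod n) = (c : ZMod n) * (du⁻¹ : (ZMod n)ˣ) := by
      rw [← h1, ← hdu, mul_assoc, Units.mul_inv, mul_one]
    have h3 := congrArg ZMod.val h2
    rwa [ZMod.val_natCast_of_lt hj] at h3

/-- **`Γ₀(4M) · 1 · Γ₀(M) = ⊔_{j<4} Γ₀(4M) (1 0; Mj 1)`** for `4 ∣ M` (index `4`; for `γ = (a b; c d) ∈ Γ₀(M)`,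
`γ (1 0; Mj 1)⁻¹ ∈ Γ₀(4M)` iff `4 ∣ c/M − j d`, and `d` is odd). -/
theorem isDoubleCosetDecomp_gamma0_four_mul (M : ℕ) [NeZero M] (h4 : 4 ∣ M) :
    IsDoubleCosetDecomp ((Gamma0 (4 * M) : Subgroup SL(2, ℤ)) : Subgroup (GL (Fin 2) ℝ))
      ((Gamma0 M : Subgroup SL(2, ℤ)) : Subgroup (GL (Fin 2) ℝ)) 1
      (fun j : Fin 4 ↦ (mapGL ℝ (transpose (ModularGroup.T ^ ((M : ℤ) * ((j : ℕ) : ℤ)))) :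
        GL (Fin 2) ℝ)) := by
  haveI : NeZero (4 : ℕ) := ⟨by norm_num⟩
  refine isDoubleCosetDecomp_one_of_le (Gamma0GL_le_of_dvd ⟨4, by ring⟩)
    (fun j ↦ Subgroup.mem_map_of_mem _ (LU_mem_gamma0 M (dvd_mul_right _ _))) ?_
  rintro _ ⟨γ, hγ, rfl⟩
  obtain ⟨c₀, hc₀⟩ := dvd_entry_of_mem_Gamma0 M hγ
  have hd : IsCoprime ((4 : ℕ) : ℤ) (γ 1 1) := by
    have hcd : IsCoprime (γ 1 0) (γ 1 1) := ⟨-γ 0 1, γ 0 0, by linear_combination det_entries γ⟩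
    refine hcd.of_isCoprime_of_dvd_left ?_
    rw [hc₀]
    exact dvd_mul_of_dvd_left (Int.natCast_dvd_natCast.mpr h4) c₀
  have key : ∀ j : Fin 4,
      (mapGL ℝ γ : GL (Fin 2) ℝ) *
          (mapGL ℝ (transpose (ModularGroup.T ^ ((M : ℤ) * ((j : ℕ) : ℤ)))))⁻¹ ∈
        ((Gamma0 (4 * M) : Subgroup SL(2, ℤ)) : Subgroup (GL (Fin 2) ℝ)) ↔
      ((4 : ℕ) : ℤ) ∣ c₀ - ((j : ℕ) : ℤ) * γ 1 1 := by
    intro j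
    rw [mapGL_mul_inv_mem_gamma0_iff]
    simp only [coe_LU, Matrix.of_apply, Matrix.cons_val', Matrix.cons_val_zero,
      Matrix.cons_val_one, Matrix.cons_val_fin_one]
    rw [hc₀, show (M : ℤ) * c₀ * 1 - γ 1 1 * ((M : ℤ) * ((j : ℕ) : ℤ)) =
      (M : ℤ) * (c₀ - ((j : ℕ) : ℤ) * γ 1 1) by ring]
    push_cast
    have hM0 : (M : ℤ) ≠ 0 := by exact_mod_cast NeZero.ne M
    rw [mul_comm (4 : ℤ) (M : ℤ)]
    exact mul_dvd_mul_iff_left hM0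
  simp_rw [key]
  exact existsUnique_fin_dvd_sub_mul_of_isCoprime 4 c₀ _ hd

/-- **The degeneracy trace `S_k(Γ₀(4M)) → S_k(Γ₀(M))` for `4 ∣ M` is the four-term coset sum**
`Tr f = ∑_{j<4} f ∣[k] (1 0; Mj 1)`. -/
theorem coe_adjDegeneracyMap0_one_four_mul_eq_sum (k : ℤ) (M : ℕ) [NeZero M] [NeZero (4 * M)] (h4 : 4 ∣ M)
    (f : CuspForm (Gamma0 (4 * M)) k) :
    (⇑(adjDegeneracyMap0 (4 * M) M 1 k f) : ℍ → ℂ) =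
      ∑ j : Fin 4, ⇑f ∣[k] (mapGL ℝ (transpose (ModularGroup.T ^ ((M : ℤ) * ((j : ℕ) : ℤ)))) :
        GL (Fin 2) ℝ) := by
  rw [adjDegeneracyMap0_one_eq_restrictLevel]
  exact coe_restrictLevel_eq_sum k _ _ (isDoubleCosetDecomp_gamma0_four_mul M h4) f

/-! ### §2 `w_N t_{j/4} w_N` and `w_N t_{1/2} w_N` as slashes by lower unipotents (`N = 4M`, `4 ∣ M`) -/

/-- `(t_{j/4} f)(τ) = f(τ + j/4)` at weight `2`, `16 ∣ N` (from p2's generic upper-translation lemma). -/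
theorem quarterTranslate_two_apply {N : ℕ} [NeZero N] (h16 : 16 ∣ N) (j : ℕ) (f : CuspForm (Gamma0 N) 2) (τ : ℍ) :
    quarterTranslate N 2 j f τ = f ((((j : ℤ) : ℝ) / (4 : ℕ)) +ᵥ τ) := by
  haveI : NeZero (4 : ℕ) := ⟨by norm_num⟩
  have h := cuspHeckeOperator_upperTranslate_two_apply (h := 4) (by simpa using h16) zmod_four_key j
    (val_glCast_quarterTranslateGL j) f τ
  have e : (⇑(quarterTranslate N 2 j f) : ℍ → ℂ) =
      (((16 : ℝ) ^ (1 - ((2 : ℤ) : ℝ) / 2) : ℝ) : ℂ) • ⇑(cuspHeckeOperatorₗ (Gamma0 N) 2 (quarterTranslateGL j) f) := by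
    unfold quarterTranslate
    rw [LinearMap.smul_apply, CuspForm.IsGLPos.coe_smul]
  have e' := congrFun e τ
  rw [Pi.smul_apply, h, smul_eq_mul] at e'
  rw [e']
  norm_num

/-- pointwise `w_N t_{j/4} w_N = slash by (1 0; −Mj 1)` at weight `2`, `N = 4M`, `4 ∣ M`. -/
theorem fricke_quarterTranslate_fricke_apply (M : ℕ) [NeZero M] [NeZero (4 * M)] (h4 : 4 ∣ M) (j : ℕ)
    (y : CuspForm (Gamma0 (4 * M)) 2) (τ : ℍ) :
    frickeInvolution (4 * M) 2 (quarterTranslate (4 * M) 2 j (frickeInvolution (4 * M) 2 y)) τ =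
      (⇑y ∣[(2 : ℤ)] (transpose (ModularGroup.T ^ (-((M : ℤ) * j))) : SL(2, ℤ))) τ := by
  have h16 : 16 ∣ 4 * M := by obtain ⟨m, rfl⟩ := h4; exact ⟨m, by ring⟩
  have hN0 : ((4 * M : ℕ) : ℂ) ≠ 0 := by exact_mod_cast NeZero.ne (4 * M)
  have hτ : (τ : ℂ) ≠ 0 := τ.ne_zero
  have hfr := frickeInvolution_apply_eq_slash_holds (4 * M) 2
  have hc : (((4 * M : ℕ) : ℝ) ^ (1 - ((2 : ℤ) : ℝ) / 2) : ℝ) = 1 := by norm_num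
  rw [hfr, hc, Complex.ofReal_one, one_smul, ModularForm.slash_apply, σ_glCast,
    quarterTranslate_two_apply h16, hfr, hc, Complex.ofReal_one, one_smul,
    ModularForm.slash_apply, σ_glCast, det_glCast_frickeGL, ModularForm.SL_slash_apply]
  set τ₁ : ℍ := ((((j : ℤ) : ℝ) / (4 : ℕ) : ℝ)) +ᵥ glCast (frickeGL (4 * M) : GL (Fin 2) ℚ) • τ with hτ₁def
  have hτ₁ : (τ₁ : ℂ) = (j : ℂ) / 4 - (((4 * M : ℕ) : ℂ) * τ)⁻¹ := by
    rw [hτ₁def, coe_vadd, coe_frickeGL_smul]; push_cast; ring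
  have hτ₁0 : (τ₁ : ℂ) ≠ 0 := τ₁.ne_zero
  have hM0 : (M : ℂ) ≠ 0 := by exact_mod_cast NeZero.ne M
  have hN : ((4 * M : ℕ) : ℂ) = 4 * (M : ℂ) := by push_cast; ring
  have hden2 : ((((-((M : ℤ) * j)) : ℤ) : ℝ) : ℂ) * (τ : ℂ) + (((1 : ℤ) : ℝ) : ℂ) ≠ 0 := by
    have h := denom_ne_zero (mapGL ℝ (transpose (ModularGroup.T ^ (-((M : ℤ) * j))) : SL(2, ℤ))) τ
    rw [denom, val_mapGL_LU] at h
    simpa using h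
  have hA : (-((M : ℂ) * j)) * (τ : ℂ) + 1 ≠ 0 := by push_cast at hden2; exact hden2
  have hB : ((4 * M : ℕ) : ℂ) * ((j : ℂ) / 4 - (((4 * M : ℕ) : ℂ) * τ)⁻¹) ≠ 0 := by
    rw [← hτ₁]; exact mul_ne_zero hN0 hτ₁0
  rw [hN] at hB
  have hA1 : (1 : ℂ) - τ * M * j ≠ 0 := by intro h; apply hA; linear_combination h
  have hA2 : (-1 : ℂ) + τ * M * j ≠ 0 := by intro h; apply hA; linear_combination -h
  have hP : glCast (frickeGL (4 * M) : GL (Fin 2) ℚ) • τ₁ =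
      (transpose (ModularGroup.T ^ (-((M : ℤ) * j))) : SL(2, ℤ)) • τ := by
    apply UpperHalfPlane.ext
    rw [coe_frickeGL_smul, coe_specialLinearGroup_apply, coe_LU, hτ₁, hN]
    simp only [Matrix.of_apply, Matrix.cons_val', Matrix.cons_val_zero, Matrix.cons_val_one,
      Matrix.cons_val_fin_one, eq_intCast]
    push_cast
    field_simp
    rw [add_zero, show ((M : ℂ) * j * τ - 1) = -(-((M : ℂ) * j * τ) + 1) by ring, div_neg, neg_neg]
  rw [hP, ModularGroup.denom_apply, denom, denom, val_glCast_frickeGL, coe_LU]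
  simp only [Matrix.of_apply, Matrix.cons_val', Matrix.cons_val_zero, Matrix.cons_val_one,
    Matrix.cons_val_fin_one, Nat.abs_cast, show (2 : ℤ) - 1 = 1 by norm_num, zpow_neg, zpow_ofNat]
  rw [hτ₁]
  push_cast
  simp only [pow_one, add_zero]
  field_simp
  ring

/-- At `16 ∣ N` the half-translation is the quarter-translation with `j = 2` (both are `f ↦ f(· + ½)` at weight `2`). -/
theorem halfTranslate_two_eq_quarterTranslate_two {N : ℕ} [NeZero N] (h16 : 16 ∣ N) (f : CuspForm (Gamma0 N) 2) :
    halfTranslate N 2 f = quarterTranslate N 2 2 f := by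
  have h4 : 4 ∣ N := (show (4 : ℕ) ∣ 16 by norm_num).trans h16
  apply DFunLike.ext
  intro τ
  rw [halfTranslate_two_apply h4, quarterTranslate_two_apply h16]
  norm_num

/-- pointwise `w_N t_{1/2} w_N = slash by (1 0; −2M 1)` at weight `2`, `N = 4M`, `4 ∣ M`. -/
theorem fricke_halfTranslate_fricke_apply (M : ℕ) [NeZero M] [NeZero (4 * M)] (h4 : 4 ∣ M)
    (y : CuspForm (Gamma0 (4 * M)) 2) (τ : ℍ) :
    frickeInvolution (4 * M) 2 (halfTranslate (4 * M) 2 (frickeInvolution (4 * M) 2 y)) τ =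
      (⇑y ∣[(2 : ℤ)] (transpose (ModularGroup.T ^ (-((M : ℤ) * (2 : ℕ)))) : SL(2, ℤ))) τ := by
  have h16 : 16 ∣ 4 * M := by obtain ⟨m, rfl⟩ := h4; exact ⟨m, by ring⟩
  rw [halfTranslate_two_eq_quarterTranslate_two h16]
  exact fricke_quarterTranslate_fricke_apply M h4 2 y τ

/-! ### §3 Assembly: E-imc-163s -/

/-- The trace identity at one level `N = 4M`, `4 ∣ M`. -/
theorem traceQuarterIdentity (M : ℕ) [NeZero M] [NeZero (4 * M)] (h4 : 4 ∣ M)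
    (y : CuspForm (Gamma0 (4 * M)) 2) :
    degeneracyMap0 M (4 * M) 1 2 (adjDegeneracyMap0 (4 * M) M 1 2 y)
      = y + frickeInvolution (4 * M) 2 (halfTranslate (4 * M) 2 (frickeInvolution (4 * M) 2 y))
          + frickeInvolution (4 * M) 2 (ramanujanFour (4 * M) 2 (frickeInvolution (4 * M) 2 y)) := by
  apply DFunLike.ext
  intro τ
  have hL := congrFun (coe_degeneracyMap0_one M (4 * M) 2 ⟨4, by ring⟩ (adjDegeneracyMap0 (4 * M) M 1 2 y)) τ
  rw [hL, coe_adjDegeneracyMap0_one_four_mul_eq_sum 2 M h4 y, Finset.sum_apply, Fin.sum_univ_four,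
    ramanujanFour_eq_quarterTranslate_add, LinearMap.add_apply, map_add]
  simp only [CuspForm.coe_add, Pi.add_apply, fricke_quarterTranslate_fricke_apply M h4,
    fricke_halfTranslate_fricke_apply M h4,
    Fin.val_zero, Fin.val_one, Fin.val_two, Nat.cast_zero, Nat.cast_one, Nat.cast_ofNat, mul_zero]
  have h0 : (⇑y ∣[(2 : ℤ)] (mapGL ℝ (transpose (ModularGroup.T ^ (0 : ℤ))) : GL (Fin 2) ℝ)) = ⇑y :=
    SlashInvariantFormClass.slash_action_eq y _ (Subgroup.mem_map_of_mem _ (LU_mem_gamma0 (4 * M) (dvd_zero _)))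
  have h2 : (⇑y ∣[(2 : ℤ)] (transpose (ModularGroup.T ^ (-((M : ℤ) * 2))) : SL(2, ℤ))) =
      ⇑y ∣[(2 : ℤ)] (mapGL ℝ (transpose (ModularGroup.T ^ ((M : ℤ) * 2))) : GL (Fin 2) ℝ) :=
    slash_lowerUnipotent_eq_of_dvd_sub y ⟨-1, by push_cast; ring⟩
  have h1 : (⇑y ∣[(2 : ℤ)] (transpose (ModularGroup.T ^ (-((M : ℤ) * 1))) : SL(2, ℤ))) =
      ⇑y ∣[(2 : ℤ)] (mapGL ℝ (transpose (ModularGroup.T ^ ((M : ℤ) * 3))) : GL (Fin 2) ℝ) :=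
    slash_lowerUnipotent_eq_of_dvd_sub y ⟨-1, by push_cast; ring⟩
  have h3 : (⇑y ∣[(2 : ℤ)] (transpose (ModularGroup.T ^ (-((M : ℤ) * 3))) : SL(2, ℤ))) =
      ⇑y ∣[(2 : ℤ)] (mapGL ℝ (transpose (ModularGroup.T ^ ((M : ℤ) * 1))) : GL (Fin 2) ℝ) :=
    slash_lowerUnipotent_eq_of_dvd_sub y ⟨-1, by push_cast; ring⟩
  have e3 : ((3 : Fin 4) : ℕ) = 3 := rfl
  simp only [e3, Nat.cast_ofNat] 
  rw [h0, h1, h2, h3]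
  ring

/-- **E-imc-163s holds.** -/
theorem traceQuarterIdentityAtTwo_holds : TraceQuarterIdentityAtTwo := by
  intro M _ h4 y
  exact traceQuarterIdentity M h4 y

end Summit.BirchSwinnertonDyer.Rank1Residual.ManinAdditive.NeronOmegaTwo

end
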